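import Literature.Probability.LatticeModels.LatticePotentialKernelHeat
import Literature.Probability.LatticeModels.LatticePotentialKernelLog
import Literature.Probability.LatticeModels.LatticePotentialKernelBounds
import HarnessLib

/-!
# Asymptotics of the planar potential kernel: `a(x) = (1/π) log |x| + κ + o(1)`

Topic `Literature/Probability/LatticeModels`; the planar (`d = 2`) counterpart of
`LatticeGreenAsymptotics.lean` (`G(x) = a_d|x|^{2-d} + O(|x|^{-d})`, `d ≥ 3`). For the potential
kernel `a = latticePotentialKernel 2` of `LatticePotentialKernel.lean` (`Δ a = 2δ₀`,
`a(x) = (2π)^{-2}∫(1 - cos(p·x))/ε(p) dp`) we PROVE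

* **`latticePotentialKernel_two_asymptotics`** — there is a constant `κ` with
  `a(x) - (2π)⁻¹ log (x₀² + x₁²) → κ` as `x → ∞` in `ℤ²` (i.e. along the cofinite filter):
  `a(x) = (1/π) log |x| + κ + o(1)`.

This is Lawler–Limic 2010, Thm. 4.4.4 (Stöhr 1950; Fukai–Uchiyama 1996; Kozma–Schreiber 2004 for
sharper expansions) in the normalisation `Δ a = 2δ₀` (half the random-walk potential kernel, whose
constant is `(2/π) log|x| + (2γ + log 8)/π`); only the EXISTENCE of `κ` is recorded, which is what
the convergence of lattice Green functions to continuum Green functions consumes (the fundamental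
solution `-a/2 = -(1/2π) log|x| - κ/2 + o(1)` of `-Δ`).

Proof (heat-kernel route, as in `LatticeGreenAsymptotics.lean`): by
`latticePotentialKernel_two_eq_integral`, `a(x) = ∫₀^∞ (q_t(0)² - q_t(x₀)q_t(x₁)) dt`; on `(0,1]`
the second term is `O((1+|x|²)⁻¹)` (`srwHeatKernel_decay`) and the first a constant `C₀`; on
`(1,∞)` one writes `q q = φ φ + (q q - φ φ)` with the Gaussian kernel `φ_t`: the constant
`C₁ = ∫₁^∞ (q_t(0)² - φ_t(0)²) dt` and the error `∫₁^∞ (q_t(x₀)q_t(x₁) - φ_t(x₀)φ_t(x₁)) dt =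
O(|x|⁻¹)` come from the Gaussian-weighted local limit theorem `srwHeatKernel_lclt`
(`|q - φ| ≤ Bt^{-3/2}(1 + m²/t)⁻¹`) and `t²(1 + |x|²/t) = t(t + |x|²) ≥ 2 t^{3/2}|x|`; the main
term `∫₁^∞ (φ_t(0)² - φ_t(x₀)φ_t(x₁)) dt = (2π)⁻¹ ∫₁^∞ (1 - e^{-|x|²/2t}) dt/t = (2π)⁻¹ F(|x|²/2)`
is the logarithmic integral of `LatticePotentialKernelLog.lean`, `F(σ) = log σ + L + o(1)`.
Hence `κ = C₀ + C₁ + (L - log 2)/(2π)`. Everything is proved; no named fact.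

## References

* G. F. Lawler, V. Limic, *Random Walk: A Modern Introduction* (2010), §4.4.1, Thm. 4.4.4
  [LawlerLimic2010].
* G. F. Lawler, *Intersections of Random Walks* (1991), Thm. 1.6.2 [Lawler1991].
-/

noncomputable section

open MeasureTheory Set Filter Real
open scoped Topology

namespace Literature.Probability.LatticeModels

/-! ### The asymptotics -/

/-- **Asymptotics of the planar potential kernel** (Lawler–Limic 2010, Thm. 4.4.4, in the
normalisation `Δ a = 2δ₀`): there is a constant `κ` such that
`a(x) - (2π)⁻¹ log (x₀² + x₁²) → κ` as `x → ∞` in `ℤ²`, i.e. `a(x) = (1/π) log|x| + κ + o(1)`.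
[cite: LawlerLimic2010, Thm. 4.4.4] -/
theorem latticePotentialKernel_two_asymptotics : ∃ κ : ℝ,
    Tendsto (fun x : Site 2 => latticePotentialKernel 2 x -
      (2 * π)⁻¹ * Real.log (((x 0 : ℤ) : ℝ) ^ 2 + ((x 1 : ℤ) : ℝ) ^ 2)) cofinite (𝓝 κ) := by
  obtain ⟨A, hA0, hA⟩ := srwHeatKernel_decay 1
  obtain ⟨B, hB0, hB⟩ := srwHeatKernel_lclt 1
  set C : ℝ := 2 * Real.exp (1 / 2) with hC
  have hC0 : 0 < C := by positivity
  have hπ := Real.pi_pos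
  -- the pieces
  set C₀ : ℝ := ∫ t in Ioc (0 : ℝ) 1, srwHeatKernel t 0 ^ 2 with hC₀
  set C₁ : ℝ := ∫ t in Ioi (1 : ℝ), (srwHeatKernel t 0 ^ 2 - gaussHeatKernel t 0 ^ 2) with hC₁
  set κ : ℝ := C₀ + C₁ + (2 * π)⁻¹ * (logIntegralConst - Real.log 2) with hκ
  refine ⟨κ, ?_⟩
  set s : Site 2 → ℝ := fun x => ((x 0 : ℤ) : ℝ) ^ 2 + ((x 1 : ℤ) : ℝ) ^ 2 with hs
  set I₁ : Site 2 → ℝ := fun x => ∫ t in Ioc (0 : ℝ) 1, srwHeatKernel t (x 0) * srwHeatKernel t (x 1) with hI₁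
  set I₂ : Site 2 → ℝ := fun x =>
    ∫ t in Ioi (1 : ℝ), (srwHeatKernel t (x 0) * srwHeatKernel t (x 1) - gaussHeatKernel t (x 0) * gaussHeatKernel t (x 1)) with hI₂
  have hs0 : ∀ x, 0 ≤ s x := fun x => by positivity
  have hs1 : ∀ x : Site 2, x ≠ 0 → 1 ≤ s x := by
    intro x hx
    have h : x 0 ≠ 0 ∨ x 1 ≠ 0 := by
      by_contra hc
      push Not at hc
      exact hx (by ext i; fin_cases i <;> simp [hc.1, hc.2])
    have hsq : ∀ z : ℤ, z ≠ 0 → (1 : ℝ) ≤ (z : ℝ) ^ 2 := fun z hz => by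
      have h1 : 1 ≤ |z| := Int.one_le_abs hz
      have h2 : (1 : ℝ) ≤ |(z : ℝ)| := by exact_mod_cast h1
      nlinarith [abs_nonneg (z : ℝ), sq_abs (z : ℝ)]
    show (1 : ℝ) ≤ ((x 0 : ℤ) : ℝ) ^ 2 + ((x 1 : ℤ) : ℝ) ^ 2
    rcases h with h0 | h1
    · nlinarith [hsq _ h0, sq_nonneg ((x 1 : ℤ) : ℝ)]
    · nlinarith [hsq _ h1, sq_nonneg ((x 0 : ℤ) : ℝ)]
  have hstend : Tendsto s cofinite atTop := tendsto_sum_sq_cofinite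
  -- pointwise kernel facts
  have hq1 : ∀ t : ℝ, 0 ≤ t → ∀ m : ℤ, |srwHeatKernel t m| ≤ 1 := fun t ht m => abs_srwHeatKernel_le_one ht m
  have hqA : ∀ t : ℝ, 1 ≤ t → ∀ m : ℤ, |srwHeatKernel t m| ≤ A * t ^ (-(1 / 2 : ℝ)) * ((1 + (m : ℝ) ^ 2 / t) ^ 1)⁻¹ := by
    intro t ht m
    have h := hA t (by linarith) m
    rwa [max_eq_right ht] at h
  have hφC : ∀ t : ℝ, 0 < t → ∀ m : ℝ, |gaussHeatKernel t m| ≤ C * t ^ (-(1 / 2 : ℝ)) * ((1 + m ^ 2 / t) ^ 1)⁻¹ := by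
    intro t ht m
    rw [abs_of_nonneg (gaussHeatKernel_nonneg t m)]
    exact gaussHeatKernel_le_weight_one ht m
  -- the product bound on `(1, ∞)`: `|q q - φ φ| ≤ B(A+C) t⁻² w₀ w₁`
  have hprod : ∀ t : ℝ, 1 ≤ t → ∀ a b : ℤ,
      |srwHeatKernel t a * srwHeatKernel t b - gaussHeatKernel t a * gaussHeatKernel t b| ≤ B * (A + C) * t ^ (-(2 : ℝ)) *
        (((1 + (a : ℝ) ^ 2 / t) ^ 1)⁻¹ * ((1 + (b : ℝ) ^ 2 / t) ^ 1)⁻¹) := by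
    intro t ht a b
    have ht0 : 0 < t := by linarith
    have hda := hB t ht a
    have hdb := hB t ht b
    have hqb := hqA t ht b
    have hφa := hφC t ht0 a
    have hw0 : 0 ≤ ((1 + (a : ℝ) ^ 2 / t) ^ 1)⁻¹ := by positivity
    have hw1 : 0 ≤ ((1 + (b : ℝ) ^ 2 / t) ^ 1)⁻¹ := by positivity
    have ht32 : 0 ≤ t ^ (-(3 / 2 : ℝ)) := Real.rpow_nonneg ht0.le _
    have ht12 : 0 ≤ t ^ (-(1 / 2 : ℝ)) := Real.rpow_nonneg ht0.le _
    have hpow : t ^ (-(3 / 2 : ℝ)) * t ^ (-(1 / 2 : ℝ)) = t ^ (-(2 : ℝ)) := by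
      rw [← Real.rpow_add ht0]; norm_num
    calc |srwHeatKernel t a * srwHeatKernel t b - gaussHeatKernel t a * gaussHeatKernel t b|
        = |(srwHeatKernel t a - gaussHeatKernel t a) * srwHeatKernel t b + gaussHeatKernel t a * (srwHeatKernel t b - gaussHeatKernel t b)| := by ring_nf
      _ ≤ |srwHeatKernel t a - gaussHeatKernel t a| * |srwHeatKernel t b| + |gaussHeatKernel t a| * |srwHeatKernel t b - gaussHeatKernel t b| := by
          refine (abs_add_le _ _).trans ?_
          rw [abs_mul, abs_mul]
      _ ≤ (B * t ^ (-(3 / 2 : ℝ)) * ((1 + (a : ℝ) ^ 2 / t) ^ 1)⁻¹) *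
            (A * t ^ (-(1 / 2 : ℝ)) * ((1 + (b : ℝ) ^ 2 / t) ^ 1)⁻¹) +
          (C * t ^ (-(1 / 2 : ℝ)) * ((1 + (a : ℝ) ^ 2 / t) ^ 1)⁻¹) *
            (B * t ^ (-(3 / 2 : ℝ)) * ((1 + (b : ℝ) ^ 2 / t) ^ 1)⁻¹) :=
          add_le_add (mul_le_mul hda hqb (abs_nonneg _) (mul_nonneg (mul_nonneg hB0.le ht32) hw0))
            (mul_le_mul hφa hdb (abs_nonneg _) (mul_nonneg (mul_nonneg hC0.le ht12) hw0))
      _ = B * (A + C) * (t ^ (-(3 / 2 : ℝ)) * t ^ (-(1 / 2 : ℝ))) *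
            (((1 + (a : ℝ) ^ 2 / t) ^ 1)⁻¹ * ((1 + (b : ℝ) ^ 2 / t) ^ 1)⁻¹) := by ring
      _ = _ := by rw [hpow]
  -- integrability of the pieces
  have hIoc_int : ∀ a b : ℤ, IntegrableOn (fun t => srwHeatKernel t a * srwHeatKernel t b) (Ioc (0 : ℝ) 1) := by
    intro a b
    refine Measure.integrableOn_of_bounded (measure_Ioc_lt_top (a := (0 : ℝ)) (b := 1)).ne
      (((continuous_srwHeatKernel_left a).mul (continuous_srwHeatKernel_left b)).aestronglyMeasurable)
      (M := 1) ?_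
    filter_upwards [ae_restrict_mem measurableSet_Ioc] with t ht
    rw [Real.norm_eq_abs, abs_mul]
    calc |srwHeatKernel t a| * |srwHeatKernel t b| ≤ 1 * 1 :=
          mul_le_mul (hq1 t ht.1.le a) (hq1 t ht.1.le b) (abs_nonneg _) zero_le_one
      _ = 1 := one_mul 1
  have hrpow2 : IntegrableOn (fun t : ℝ => t ^ (-(2 : ℝ))) (Ioi 1) :=
    integrableOn_Ioi_rpow_of_lt (by norm_num) one_pos
  have hmeas_diff : ∀ a b : ℤ, AEStronglyMeasurable (fun t => srwHeatKernel t a * srwHeatKernel t b - gaussHeatKernel t a * gaussHeatKernel t b)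
      (volume.restrict (Ioi (1 : ℝ))) := by
    intro a b
    refine (ContinuousOn.aestronglyMeasurable ?_ measurableSet_Ioi)
    refine ((continuous_srwHeatKernel_left a).mul (continuous_srwHeatKernel_left b)).continuousOn.sub ?_
    exact ((continuousOn_gaussHeatKernel_left a).mul (continuousOn_gaussHeatKernel_left b)).mono
      (Ioi_subset_Ioi zero_le_one)
  have hIoi_int : ∀ a b : ℤ, IntegrableOn (fun t => srwHeatKernel t a * srwHeatKernel t b - gaussHeatKernel t a * gaussHeatKernel t b) (Ioi (1 : ℝ)) := by
    intro a b
    refine (hrpow2.const_mul (B * (A + C))).mono' (hmeas_diff a b) ?_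
    filter_upwards [ae_restrict_mem measurableSet_Ioi] with t ht
    have ht1 : 1 ≤ t := le_of_lt ht
    have ht0 : 0 < t := by linarith
    rw [Real.norm_eq_abs]
    refine (hprod t ht1 a b).trans ?_
    have hw : ((1 + (a : ℝ) ^ 2 / t) ^ 1)⁻¹ * ((1 + (b : ℝ) ^ 2 / t) ^ 1)⁻¹ ≤ 1 :=
      mul_le_one₀ (weight_le_one ht0 a) (by positivity) (weight_le_one ht0 b)
    have h0 : 0 ≤ B * (A + C) * t ^ (-(2 : ℝ)) := by positivity
    calc B * (A + C) * t ^ (-(2 : ℝ)) * (((1 + (a : ℝ) ^ 2 / t) ^ 1)⁻¹ * ((1 + (b : ℝ) ^ 2 / t) ^ 1)⁻¹)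
        ≤ B * (A + C) * t ^ (-(2 : ℝ)) * 1 := by gcongr
      _ = B * (A + C) * t ^ (-(2 : ℝ)) := mul_one _
  have hlog_int : ∀ σ : ℝ, 0 ≤ σ → IntegrableOn (fun t : ℝ => (1 - Real.exp (-(σ / t))) / t) (Ioi 1) := by
    intro σ hσ
    refine (hrpow2.const_mul σ).mono' ?_ ?_
    · refine ContinuousOn.aestronglyMeasurable ?_ measurableSet_Ioi
      refine ContinuousOn.div ?_ continuousOn_id fun t ht => ne_of_gt (zero_lt_one.trans ht)
      exact continuousOn_const.sub (Real.continuous_exp.comp_continuousOn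
        ((continuousOn_const.div continuousOn_id fun t ht => ne_of_gt (zero_lt_one.trans ht)).neg))
    · filter_upwards [ae_restrict_mem measurableSet_Ioi] with t ht
      have ht0 : 0 < t := zero_lt_one.trans ht
      have h1 : 0 ≤ 1 - Real.exp (-(σ / t)) := by
        rw [sub_nonneg, Real.exp_le_one_iff, neg_nonpos]; positivity
      have h2 : 1 - Real.exp (-(σ / t)) ≤ σ / t := by
        have := Real.add_one_le_exp (-(σ / t)); linarith
      rw [Real.norm_eq_abs, abs_of_nonneg (div_nonneg h1 ht0.le), div_le_iff₀ ht0]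
      calc 1 - Real.exp (-(σ / t)) ≤ σ / t := h2
        _ = σ * t ^ (-(2 : ℝ)) * t := by
            rw [Real.rpow_neg ht0.le, show (2 : ℝ) = (2 : ℕ) by norm_num, Real.rpow_natCast]
            field_simp
  have hgauss_int : ∀ a b : ℤ, IntegrableOn (fun t => gaussHeatKernel t 0 ^ 2 - gaussHeatKernel t a * gaussHeatKernel t b) (Ioi (1 : ℝ)) := by
    intro a b
    have h : IntegrableOn (fun t : ℝ => (2 * π)⁻¹ *
        ((1 - Real.exp (-((((a : ℝ) ^ 2 + (b : ℝ) ^ 2) / 2) / t))) / t)) (Ioi 1) :=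
      (hlog_int (((a : ℝ) ^ 2 + (b : ℝ) ^ 2) / 2) (by positivity)).const_mul (2 * π)⁻¹
    refine h.congr_fun (fun t ht => ?_) measurableSet_Ioi
    exact (gaussHeatKernel_sq_sub_mul (zero_lt_one.trans ht) a b).symm
  have hq0_int : IntegrableOn (fun t => srwHeatKernel t 0 ^ 2 - gaussHeatKernel t 0 ^ 2) (Ioi (1 : ℝ)) := by
    have h := hIoi_int 0 0
    simpa only [Int.cast_zero, pow_two] using h
  -- the decomposition, for `x ≠ 0`
  have hdecomp : ∀ x : Site 2, x ≠ 0 →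
      latticePotentialKernel 2 x - (2 * π)⁻¹ * Real.log (s x) =
        (C₀ - I₁ x) + (C₁ - I₂ x) + (2 * π)⁻¹ * (logIntegral (s x / 2) - Real.log (s x / 2)) -
          (2 * π)⁻¹ * Real.log 2 := by
    intro x hx
    have hsx : 0 < s x := by linarith [hs1 x hx]
    obtain ⟨hDint, hDval⟩ := latticePotentialKernel_two_eq_integral x
    rw [hDval]
    -- split at `t = 1`
    have hsplit : ∫ t in Ioi (0 : ℝ), (srwHeatKernel t 0 ^ 2 - srwHeatKernel t (x 0) * srwHeatKernel t (x 1)) =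
        (∫ t in Ioc (0 : ℝ) 1, (srwHeatKernel t 0 ^ 2 - srwHeatKernel t (x 0) * srwHeatKernel t (x 1))) +
          ∫ t in Ioi (1 : ℝ), (srwHeatKernel t 0 ^ 2 - srwHeatKernel t (x 0) * srwHeatKernel t (x 1)) := by
      rw [← setIntegral_union Set.Ioc_disjoint_Ioi_same measurableSet_Ioi
        (hDint.mono_set Set.Ioc_subset_Ioi_self) (hDint.mono_set (Set.Ioi_subset_Ioi zero_le_one)),
        Set.Ioc_union_Ioi_eq_Ioi zero_le_one]
    -- small times
    have hsmall : ∫ t in Ioc (0 : ℝ) 1, (srwHeatKernel t 0 ^ 2 - srwHeatKernel t (x 0) * srwHeatKernel t (x 1)) = C₀ - I₁ x := by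
      have h00 := hIoc_int 0 0
      simp_rw [← pow_two] at h00
      rw [integral_sub h00 (hIoc_int (x 0) (x 1))]
    -- large times: `q q = (q(0)² - φ(0)²)·… ` rearranged
    have hlarge : ∫ t in Ioi (1 : ℝ), (srwHeatKernel t 0 ^ 2 - srwHeatKernel t (x 0) * srwHeatKernel t (x 1)) =
        C₁ - I₂ x + ∫ t in Ioi (1 : ℝ), (gaussHeatKernel t 0 ^ 2 - gaussHeatKernel t (x 0) * gaussHeatKernel t (x 1)) := by
      have hpt : ∀ t : ℝ, srwHeatKernel t 0 ^ 2 - srwHeatKernel t (x 0) * srwHeatKernel t (x 1) =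
          ((srwHeatKernel t 0 ^ 2 - gaussHeatKernel t 0 ^ 2) - (srwHeatKernel t (x 0) * srwHeatKernel t (x 1) - gaussHeatKernel t (x 0) * gaussHeatKernel t (x 1))) +
            (gaussHeatKernel t 0 ^ 2 - gaussHeatKernel t (x 0) * gaussHeatKernel t (x 1)) := fun t => by ring
      simp_rw [hpt]
      have hint1 : IntegrableOn (fun t : ℝ => (srwHeatKernel t 0 ^ 2 - gaussHeatKernel t 0 ^ 2) -
          (srwHeatKernel t (x 0) * srwHeatKernel t (x 1) -
            gaussHeatKernel t (x 0) * gaussHeatKernel t (x 1))) (Ioi 1) :=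
        hq0_int.sub (hIoi_int (x 0) (x 1))
      rw [integral_add hint1 (hgauss_int (x 0) (x 1)), integral_sub hq0_int (hIoi_int (x 0) (x 1))]
    -- the Gaussian main term is the logarithmic integral
    have hmain : ∫ t in Ioi (1 : ℝ), (gaussHeatKernel t 0 ^ 2 - gaussHeatKernel t (x 0) * gaussHeatKernel t (x 1)) =
        (2 * π)⁻¹ * logIntegral (s x / 2) := by
      rw [logIntegral, ← integral_const_mul]
      refine setIntegral_congr_fun measurableSet_Ioi fun t ht => ?_
      rw [gaussHeatKernel_sq_sub_mul (zero_lt_one.trans ht)]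
    rw [hsplit, hsmall, hlarge, hmain, Real.log_div hsx.ne' two_ne_zero]
    ring
  -- `I₁ → 0`
  have hI₁ : Tendsto I₁ cofinite (𝓝 0) := by
    have hbound : ∀ x : Site 2, |I₁ x| ≤ A ^ 2 * (1 + s x)⁻¹ := by
      intro x
      have hb : ∀ t ∈ Ioc (0 : ℝ) 1, ‖srwHeatKernel t (x 0) * srwHeatKernel t (x 1)‖ ≤ A ^ 2 * (1 + s x)⁻¹ := by
        intro t ht
        have h0 := hA t ht.1 (x 0)
        have h1 := hA t ht.1 (x 1)
        rw [max_eq_left ht.2, Real.one_rpow, mul_one, div_one] at h0 h1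
        rw [Real.norm_eq_abs, abs_mul]
        have hw : ((1 + ((x 0 : ℤ) : ℝ) ^ 2) ^ 1)⁻¹ * ((1 + ((x 1 : ℤ) : ℝ) ^ 2) ^ 1)⁻¹ ≤ (1 + s x)⁻¹ := by
          have := weight_mul_weight_le one_pos ((x 0 : ℤ) : ℝ) ((x 1 : ℤ) : ℝ)
          simp only [div_one] at this
          exact this
        calc |srwHeatKernel t (x 0)| * |srwHeatKernel t (x 1)|
            ≤ (A * ((1 + ((x 0 : ℤ) : ℝ) ^ 2) ^ 1)⁻¹) * (A * ((1 + ((x 1 : ℤ) : ℝ) ^ 2) ^ 1)⁻¹) :=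
              mul_le_mul h0 h1 (abs_nonneg _) (mul_nonneg hA0.le (by positivity))
          _ = A ^ 2 * (((1 + ((x 0 : ℤ) : ℝ) ^ 2) ^ 1)⁻¹ * ((1 + ((x 1 : ℤ) : ℝ) ^ 2) ^ 1)⁻¹) := by ring
          _ ≤ A ^ 2 * (1 + s x)⁻¹ := by gcongr
      have h := norm_setIntegral_le_of_norm_le_const
        (show volume (Ioc (0 : ℝ) 1) < ⊤ from measure_Ioc_lt_top) hb
      rw [Real.volume_real_Ioc_of_le zero_le_one, sub_zero, mul_one, Real.norm_eq_abs] at h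
      exact h
    have hmaj : Tendsto (fun x => A ^ 2 * (1 + s x)⁻¹) cofinite (𝓝 0) := by
      have h := (tendsto_inv_atTop_zero.comp (tendsto_atTop_add_const_left _ 1 hstend)).const_mul (A ^ 2)
      rw [mul_zero] at h
      exact h
    exact squeeze_zero_norm (fun x => by rw [Real.norm_eq_abs]; exact hbound x) hmaj
  -- `I₂ → 0`
  have hI₂ : Tendsto I₂ cofinite (𝓝 0) := by
    have hrpow32 : IntegrableOn (fun t : ℝ => t ^ (-(3 / 2 : ℝ))) (Ioi 1) :=
      integrableOn_Ioi_rpow_of_lt (by norm_num) one_pos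
    have hval32 : ∫ t in Ioi (1 : ℝ), t ^ (-(3 / 2 : ℝ)) = 2 := by
      rw [integral_Ioi_rpow_of_lt (by norm_num) one_pos]
      norm_num
    have hbound : ∀ x : Site 2, x ≠ 0 → |I₂ x| ≤ B * (A + C) / Real.sqrt (s x) := by
      intro x hx
      have hsx : 0 < s x := by linarith [hs1 x hx]
      have hsq : 0 < Real.sqrt (s x) := Real.sqrt_pos.2 hsx
      set c : ℝ := B * (A + C) / (2 * Real.sqrt (s x)) with hc
      have hc0 : 0 ≤ c := by positivity
      have hb : ∀ᵐ t ∂(volume.restrict (Ioi (1 : ℝ))),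
          ‖srwHeatKernel t (x 0) * srwHeatKernel t (x 1) - gaussHeatKernel t (x 0) * gaussHeatKernel t (x 1)‖ ≤ c * t ^ (-(3 / 2 : ℝ)) := by
        filter_upwards [ae_restrict_mem measurableSet_Ioi] with t ht
        have ht1 : 1 ≤ t := le_of_lt ht
        have ht0 : 0 < t := by linarith
        rw [Real.norm_eq_abs]
        refine (hprod t ht1 (x 0) (x 1)).trans ?_
        have hw := weight_mul_weight_le ht0 ((x 0 : ℤ) : ℝ) ((x 1 : ℤ) : ℝ)
        have hkey := rpow_neg_two_mul_inv_le ht0 hsx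
        have h0 : 0 ≤ B * (A + C) := by positivity
        calc B * (A + C) * t ^ (-(2 : ℝ)) *
              (((1 + ((x 0 : ℤ) : ℝ) ^ 2 / t) ^ 1)⁻¹ * ((1 + ((x 1 : ℤ) : ℝ) ^ 2 / t) ^ 1)⁻¹)
            ≤ B * (A + C) * t ^ (-(2 : ℝ)) * (1 + s x / t)⁻¹ := by gcongr
          _ = B * (A + C) * (t ^ (-(2 : ℝ)) * (1 + s x / t)⁻¹) := by ring
          _ ≤ B * (A + C) * (t ^ (-(3 / 2 : ℝ)) / (2 * Real.sqrt (s x))) := by gcongr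
          _ = c * t ^ (-(3 / 2 : ℝ)) := by rw [hc]; ring
      calc |I₂ x| = ‖∫ t in Ioi (1 : ℝ), (srwHeatKernel t (x 0) * srwHeatKernel t (x 1) - gaussHeatKernel t (x 0) * gaussHeatKernel t (x 1))‖ :=
            (Real.norm_eq_abs _).symm
        _ ≤ ∫ t in Ioi (1 : ℝ), c * t ^ (-(3 / 2 : ℝ)) :=
            norm_integral_le_of_norm_le (hrpow32.const_mul c) hb
        _ = c * 2 := by rw [integral_const_mul, hval32]
        _ = B * (A + C) / Real.sqrt (s x) := by rw [hc]; field_simp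
    have hmaj : Tendsto (fun x => B * (A + C) / Real.sqrt (s x)) cofinite (𝓝 0) := by
      have h1 : Tendsto (fun x => Real.sqrt (s x)) cofinite atTop :=
        Real.tendsto_sqrt_atTop.comp hstend
      have h2 := h1.inv_tendsto_atTop.const_mul (B * (A + C))
      rw [mul_zero] at h2
      exact h2.congr fun x => (div_eq_mul_inv _ _).symm
    refine squeeze_zero_norm' ?_ hmaj
    filter_upwards [eventually_cofinite_ne (0 : Site 2)] with x hx
    rw [Real.norm_eq_abs]
    exact hbound x hx
  -- the logarithmic term
  have hlog : Tendsto (fun x => logIntegral (s x / 2) - Real.log (s x / 2)) cofinite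
      (𝓝 logIntegralConst) :=
    tendsto_logIntegral_sub_log.comp (hstend.atTop_div_const (by norm_num))
  -- assemble
  have hlim : Tendsto (fun x => (C₀ - I₁ x) + (C₁ - I₂ x) +
      (2 * π)⁻¹ * (logIntegral (s x / 2) - Real.log (s x / 2)) - (2 * π)⁻¹ * Real.log 2)
      cofinite (𝓝 κ) := by
    have h := (((tendsto_const_nhds (x := C₀)).sub hI₁).add ((tendsto_const_nhds (x := C₁)).sub hI₂)).add
      (hlog.const_mul (2 * π)⁻¹) |>.sub (tendsto_const_nhds (x := (2 * π)⁻¹ * Real.log 2))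
    have hκ' : κ = C₀ - 0 + (C₁ - 0) + (2 * π)⁻¹ * logIntegralConst - (2 * π)⁻¹ * Real.log 2 := by
      rw [hκ]; ring
    rw [hκ']
    exact h
  refine hlim.congr' ?_
  filter_upwards [eventually_cofinite_ne (0 : Site 2)] with x hx
  exact (hdecomp x hx).symm

end Literature.Probability.LatticeModels
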